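import Summits.QuantumFields.YangMills.Theorems.PencilRigidityNPointIsotropyMopupHelpers
import Summits.QuantumFields.YangMills.Theorems.PencilRigidityPlanarToEuclideanSO4
import Summits.QuantumFields.YangMills.Theorems.LangevinControlUVOSLegsFromFemtoAndGapStubUpgradeGivens

/-!
# One-angle amplification, I: the irrational skew rotation `Q_A ∘ R₈` and its adapted frame

Support file (pure Euclidean geometry of `ℝ⁴` + algebraic integers; registered sub-goal `oneAngleSkew` of stub
`stub_oneAngleAmplification`, crux `stmt-QuantumFields-11686` `Summit.QuantumFields.YangMills.Theses.PencilRigidity.NPointIsotropy`,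
line `quarter-turn-corner-operator`). Namespace `…NPointIsotropy.QuarterTurnCornerOperator`, helpers in the
sub-namespace `OneAngle`; no `def`, no notation. `E4 = NPointIsotropy.Negative.E4 = EuclideanSpace ℝ (Fin 4)`;
`ρ t = planeRot (d := 3) 0 t` is the tree's rotation of the `(x₀,x₁)`-plane (`e₀ ↦ cos t e₀ - sin t e₁`).

**Main theorem** `oneAngleSkew`. Let `R₈` be the eighth-turn of the `(x₀,x₁)`-plane (`R₈ e₀ = (√2/2)(e₀ + e₁)`,
`R₈ e₁ = (√2/2)(-e₀ + e₁)`, `e₂, e₃` fixed) and `Q` a determinant-one isometry with `Q e₀ = -e₂`, `Q e₁ = e₁`,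
`Q e₂ = e₀`, `Q e₃ = e₃` (the quarter-turn `Q_A` of `PlanarToEuclidean.QA_spec`). Then there are a linear isometry
`P₀` of `ℝ⁴` fixing `e₃`, a constant `c > 0` and an angle `φ₀` such that, with `v = e₀ + (1+√2) e₁ + e₂`:
`P₀ v = c e₂`; the skew rotation `h = Q ∘ R₈` is the conjugate `P₀⁻¹ ∘ ρ(φ₀) ∘ P₀`; **`φ₀/2π` is irrational**;
and every determinant-one isometry fixing `v` and `e₃` is a conjugate `P₀⁻¹ ∘ ρ(t) ∘ P₀`.

Proof.
* `h v = v` (`OneAngle.skew_apply_axis`, a computation with `√2·√2 = 2`), `h e₃ = e₃`, `det h = 1`, and the trace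
  of `h` is `1 + √2/2` (`OneAngle.trace_skew`; traces via the standard-basis matrix, `OneAngle.trace_eq_sum`).
* Two Givens steps (`PlanarToEuclidean.givens`) give a determinant-one `P₀` fixing `e₃` with `P₀ v = c e₂`, `c > 0`
  (`OneAngle.exists_frame`). If `R` has determinant one and fixes `v, e₃`, its conjugate `P₀ ∘ R ∘ P₀⁻¹` fixes
  `e₂, e₃`, hence is a plane rotation `ρ(t)` (`Mopup.exists_eq_planeRot`): `R = P₀⁻¹ ρ(t) P₀`
  (`OneAngle.exists_eq_conj_rho`). Applied to `h` this gives `φ₀`, and comparing traces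
  (`tr ρ(t) = 2 cos t + 2`, `OneAngle.trace_rho`, `OneAngle.trace_conj`) `2 cos φ₀ = √2/2 - 1`.
* `OneAngle.irrational_of_two_mul_cos_eq`: if `φ₀ = 2π q`, `q ∈ ℚ`, then `2 cos φ₀` is an algebraic integer
  (Mathlib `Real.isIntegral_two_mul_cos_rat_mul_pi`), hence so is `(2 cos φ₀ + 1)² = 1/2`; but `ℤ` is
  integrally closed (Mathlib `IsIntegrallyClosed.algebraMap_eq_of_integral`) — contradiction.

Used by `PencilRigidityNPointIsotropyOneAngleCircle.lean` (closed subgroups of `ℝ`: the full circle group about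
`v`). Design note: like `PencilRigidityNPointIsotropyMopup.lean`, this file does not remove Mathlib's `SimplexCategory`
`Fintype (Fin (x.len + 1))` instance; its statements are over `EuclideanSpace ℝ (Fin 4)` and are used by `exact`.
References: folklore; I. Niven, Irrational Numbers (1956), Ch. 3, as formalised in Mathlib `NumberTheory/Niven`.
-/

noncomputable section

namespace Summit.QuantumFields.YangMills.Theorems.NPointIsotropy.QuarterTurnCornerOperator

open scoped InnerProductSpace Topology
open Literature.MathematicalPhysics.QuantumFieldTheory
open Summit.QuantumFields.YangMills.Theorems.NPointIsotropy.Negative (E4)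
open Summit.QuantumFields.YangMills.Theorems.PlanarToEuclidean
open Summit.QuantumFields.YangMills.Theorems.OSLegsFromFemtoAndGap.Upgrade
open Summit.QuantumFields.YangMills.Theorems.NPointIsotropy.ComplexRotationBandlimit.Mopup
  (exists_eq_planeRot)

namespace OneAngle

/-! ### Determinants and traces of conjugates -/

/-- The determinant of a linear isometry of `ℝ⁴` is non-zero. [folklore] -/
theorem det_ne_zero (A : E4 ≃ₗᵢ[ℝ] E4) : LinearMap.det (A.toLinearEquiv : E4 →ₗ[ℝ] E4) ≠ 0 := by
  rcases det_eq_one_or_eq_neg_one A with h | h <;> rw [h] <;> norm_num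

/-- Conjugation preserves the determinant: `det (A⁻¹ ∘ B ∘ A) = det B`. [folklore] -/
theorem det_conj (A B : E4 ≃ₗᵢ[ℝ] E4) :
    LinearMap.det ((A.trans (B.trans A.symm)).toLinearEquiv : E4 →ₗ[ℝ] E4) =
      LinearMap.det (B.toLinearEquiv : E4 →ₗ[ℝ] E4) := by
  rw [det_trans, det_trans, LinearIsometryEquiv.toLinearEquiv_symm, LinearEquiv.det_coe_symm,
    mul_comm, mul_assoc, inv_mul_cancel₀ (det_ne_zero A), mul_one]

/-- Undoing a conjugation: `B = A ∘ (A⁻¹ ∘ B ∘ A) ∘ A⁻¹`. [folklore] -/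
theorem eq_symm_trans_conj_trans (A B : E4 ≃ₗᵢ[ℝ] E4) :
    B = A.symm.trans ((A.trans (B.trans A.symm)).trans A) := by
  ext x : 1
  simp

/-- The trace of a linear endomorphism of `ℝ⁴` is the sum of its diagonal entries in the standard basis. [folklore] -/
theorem trace_eq_sum (f : E4 →ₗ[ℝ] E4) :
    LinearMap.trace ℝ E4 f = ∑ i : Fin 4, f (EuclideanSpace.single i 1) i := by
  rw [LinearMap.trace_eq_matrix_trace ℝ (EuclideanSpace.basisFun (Fin 4) ℝ).toBasis f, Matrix.trace]
  refine Finset.sum_congr rfl fun i _ => ?_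
  rw [Matrix.diag_apply, LinearMap.toMatrix_apply, OrthonormalBasis.coe_toBasis_repr_apply,
    EuclideanSpace.basisFun_repr, OrthonormalBasis.coe_toBasis, EuclideanSpace.basisFun_apply]

/-- Conjugation preserves the trace: `tr (A⁻¹ ∘ B ∘ A) = tr B`. [folklore] -/
theorem trace_conj (A B : E4 ≃ₗᵢ[ℝ] E4) :
    LinearMap.trace ℝ E4 ((A.trans (B.trans A.symm)).toLinearEquiv : E4 →ₗ[ℝ] E4) =
      LinearMap.trace ℝ E4 (B.toLinearEquiv : E4 →ₗ[ℝ] E4) := by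
  have h : ((A.trans (B.trans A.symm)).toLinearEquiv : E4 →ₗ[ℝ] E4) =
      A.symm.toLinearEquiv.conj (B.toLinearEquiv : E4 →ₗ[ℝ] E4) := by
    apply LinearMap.ext
    intro x
    simp [LinearEquiv.conj_apply]
  rw [h, LinearMap.trace_conj']

/-- The trace of the `(x₀,x₁)`-rotation by `t` is `2 cos t + 2`. [folklore] -/
theorem trace_rho (t : ℝ) :
    LinearMap.trace ℝ E4 ((planeRot (d := 3) 0 t).toLinearEquiv : E4 →ₗ[ℝ] E4) = 2 * Real.cos t + 2 := by
  rw [trace_eq_sum, Fin.sum_univ_four]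
  simp only [LinearEquiv.coe_coe, LinearIsometryEquiv.coe_toLinearEquiv]
  rw [rho_e0, rho_e1, rho_e2, rho_e3]
  simp
  ring

/-! ### The eighth-turn, the quarter-turn conjugator and their product -/

/-- The eighth-turn `R₈ = ρ(-π/4)` on `e₀`: `R₈ e₀ = (√2/2) e₀ + (√2/2) e₁`. [folklore] -/
theorem eighthTurn_e0 :
    planeRot (d := 3) 0 (-(Real.pi / 4)) (EuclideanSpace.single 0 1 : E4) =
      (Real.sqrt 2 / 2) • EuclideanSpace.single 0 1 + (Real.sqrt 2 / 2) • EuclideanSpace.single 1 1 := by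
  rw [rho_e0, Real.cos_neg, Real.sin_neg, neg_neg, Real.cos_pi_div_four, Real.sin_pi_div_four]

/-- The eighth-turn on `e₁`: `R₈ e₁ = -(√2/2) e₀ + (√2/2) e₁`. [folklore] -/
theorem eighthTurn_e1 :
    planeRot (d := 3) 0 (-(Real.pi / 4)) (EuclideanSpace.single 1 1 : E4) =
      -((Real.sqrt 2 / 2) • EuclideanSpace.single 0 1) + (Real.sqrt 2 / 2) • EuclideanSpace.single 1 1 := by
  rw [rho_e1, Real.cos_neg, Real.sin_neg, Real.cos_pi_div_four, Real.sin_pi_div_four, neg_smul]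

section Skew

variable (R₈ Q : E4 ≃ₗᵢ[ℝ] E4)
  (h8 : R₈ (EuclideanSpace.single 0 1) =
      (Real.sqrt 2 / 2) • EuclideanSpace.single 0 1 + (Real.sqrt 2 / 2) • EuclideanSpace.single 1 1 ∧
    R₈ (EuclideanSpace.single 1 1) =
      -((Real.sqrt 2 / 2) • EuclideanSpace.single 0 1) + (Real.sqrt 2 / 2) • EuclideanSpace.single 1 1 ∧
    R₈ (EuclideanSpace.single 2 1) = EuclideanSpace.single 2 1 ∧
    R₈ (EuclideanSpace.single 3 1) = EuclideanSpace.single 3 1)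
  (hQ : Q (EuclideanSpace.single 0 1) = -EuclideanSpace.single 2 1 ∧
    Q (EuclideanSpace.single 1 1) = EuclideanSpace.single 1 1 ∧
    Q (EuclideanSpace.single 2 1) = EuclideanSpace.single 0 1 ∧
    Q (EuclideanSpace.single 3 1) = EuclideanSpace.single 3 1)
include h8 hQ

/-- **The skew rotation `h = Q ∘ R₈`** (`R₈` the eighth-turn of the `(x₀,x₁)`-plane, `Q : e₀ ↦ -e₂, e₁ ↦ e₁,
e₂ ↦ e₀` a quarter-turn of the `(x₀,x₂)`-plane) fixes the vector `v = e₀ + (1+√2) e₁ + e₂`. [folklore] -/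
theorem skew_apply_axis :
    (R₈.trans Q) (EuclideanSpace.single 0 1 + (1 + Real.sqrt 2) • EuclideanSpace.single 1 1 +
        EuclideanSpace.single 2 1) =
      EuclideanSpace.single 0 1 + (1 + Real.sqrt 2) • EuclideanSpace.single 1 1 + EuclideanSpace.single 2 1 := by
  obtain ⟨h80, h81, h82, -⟩ := h8
  obtain ⟨hQ0, hQ1, hQ2, -⟩ := hQ
  simp only [LinearIsometryEquiv.trans_apply, map_add, map_smul, h80, h81, h82, map_neg, hQ0, hQ1, hQ2]
  have h2 : Real.sqrt 2 * Real.sqrt 2 = 2 := Real.mul_self_sqrt (by norm_num)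
  ext j
  fin_cases j <;> simp <;> nlinarith [h2]

/-- The skew rotation fixes `e₃`. [folklore] -/
theorem skew_apply_e3 : (R₈.trans Q) (EuclideanSpace.single 3 1) = EuclideanSpace.single 3 1 := by
  simp only [LinearIsometryEquiv.trans_apply, h8.2.2.2, hQ.2.2.2]

/-- **The trace of the skew rotation is `1 + √2/2`.** [folklore] -/
theorem trace_skew :
    LinearMap.trace ℝ E4 ((R₈.trans Q).toLinearEquiv : E4 →ₗ[ℝ] E4) = 1 + Real.sqrt 2 / 2 := by
  obtain ⟨h80, h81, h82, h83⟩ := h8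
  obtain ⟨hQ0, hQ1, hQ2, hQ3⟩ := hQ
  rw [trace_eq_sum, Fin.sum_univ_four]
  simp only [LinearEquiv.coe_coe, LinearIsometryEquiv.coe_toLinearEquiv, LinearIsometryEquiv.trans_apply,
    h80, h81, h82, h83, map_add, map_smul, map_neg, hQ0, hQ1, hQ2, hQ3]
  simp
  ring

end Skew

/-! ### The angle of the skew rotation is an irrational multiple of `π` -/

/-- **Irrationality of the skew angle.** If `2 cos φ = √2/2 - 1` then `φ/(2π)` is irrational: otherwise
`2 cos φ` is an algebraic integer (Mathlib `Real.isIntegral_two_mul_cos_rat_mul_pi`), hence so is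
`(2 cos φ + 1)² = 1/2`, which is rational and not an integer — impossible, `ℤ` being integrally closed. [folklore] -/
theorem irrational_of_two_mul_cos_eq {φ : ℝ} (h : 2 * Real.cos φ = Real.sqrt 2 / 2 - 1) :
    Irrational (φ / (2 * Real.pi)) := by
  rintro ⟨q, hq⟩
  have h2π : (2 * Real.pi) ≠ 0 := by positivity
  have hφ : φ = ((2 * q : ℚ) : ℝ) * Real.pi := by
    rw [eq_div_iff h2π] at hq
    push_cast
    linarith
  have hint : IsIntegral ℤ (2 * Real.cos φ) := by
    rw [hφ]
    exact Real.isIntegral_two_mul_cos_rat_mul_pi _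
  have hhalf : IsIntegral ℤ ((1 / 2 : ℚ) : ℝ) := by
    have h1 : IsIntegral ℤ ((2 * Real.cos φ + 1) ^ 2) := (hint.add isIntegral_one).pow 2
    have h2 : (2 * Real.cos φ + 1) ^ 2 = ((1 / 2 : ℚ) : ℝ) := by
      rw [h, sub_add_cancel, div_pow, Real.sq_sqrt (by norm_num : (0 : ℝ) ≤ 2)]
      norm_num
    rwa [h2] at h1
  rw [IsIntegral.ratCast_iff] at hhalf
  obtain ⟨k, hk⟩ := IsIntegrallyClosed.algebraMap_eq_of_integral hhalf
  have hk' : (k : ℚ) * 2 = 1 := by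
    rw [eq_intCast] at hk
    rw [hk]
    norm_num
  have hk2 : k * 2 = 1 := by exact_mod_cast hk'
  omega

/-! ### A frame adapted to the axis; rotations about the axis are conjugate plane rotations -/

/-- **A frame adapted to an axis.** For a non-zero `v ⊥ e₃` there is a determinant-one isometry `P₀` fixing
`e₃` and mapping `v` to a positive multiple of `e₂` (two Givens steps of `PencilRigidityPlanarToEuclideanSO4`).
[folklore] -/
theorem exists_frame (v : E4) (hv3 : v 3 = 0) (hv : v ≠ 0) :
    ∃ P₀ : E4 ≃ₗᵢ[ℝ] E4, LinearMap.det (P₀.toLinearEquiv : E4 →ₗ[ℝ] E4) = 1 ∧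
      P₀ (EuclideanSpace.single 3 1) = EuclideanSpace.single 3 1 ∧
      ∃ c : ℝ, 0 < c ∧ P₀ v = c • EuclideanSpace.single 2 1 := by
  obtain ⟨G1, hG1det, hG1fix, hG1a, -, hG1c⟩ := givens 0 1 (by decide) v
  obtain ⟨G2, hG2det, hG2fix, hG2a, hG2b, hG2c⟩ := givens 1 2 (by decide) (G1 v)
  set w : E4 := G2 (G1 v) with hw
  have hw0 : w 0 = 0 := by rw [hw, hG2c 0 (by decide) (by decide), hG1a]
  have hw1 : w 1 = 0 := hG2a
  have hw3 : w 3 = 0 := by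
    rw [hw, hG2c 3 (by decide) (by decide), hG1c 3 (by decide) (by decide), hv3]
  have hwne : w ≠ 0 := by
    intro h0
    apply hv
    have h : ‖w‖ = ‖v‖ := by rw [hw, LinearIsometryEquiv.norm_map, LinearIsometryEquiv.norm_map]
    rw [h0, norm_zero] at h
    exact norm_eq_zero.1 h.symm
  have hw2 : 0 < w 2 := by
    rcases (hG2b : 0 ≤ w 2).lt_or_eq with hlt | heq
    · exact hlt
    · exfalso
      apply hwne
      ext j
      fin_cases j <;> simp [hw0, hw1, ← heq, hw3]
  refine ⟨G1.trans G2, by rw [det_trans, hG1det, hG2det, one_mul], ?_, w 2, hw2, ?_⟩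
  · rw [LinearIsometryEquiv.trans_apply, hG1fix 3 (by decide) (by decide), hG2fix 3 (by decide) (by decide)]
  · rw [LinearIsometryEquiv.trans_apply, ← hw]
    ext j
    fin_cases j <;> simp [hw0, hw1, hw3]

/-- **Rotations about an axis are conjugate plane rotations.** In a frame `P₀` (fixing `e₃`, `P₀ v = c e₂`,
`c > 0`), every determinant-one isometry fixing `v` and `e₃` is `P₀⁻¹ ∘ ρ t ∘ P₀` for some angle `t`
(`ρ t = planeRot 0 t`): its `P₀`-conjugate fixes `e₂, e₃` (`Mopup.exists_eq_planeRot`). [folklore] -/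
theorem exists_eq_conj_rho (P₀ : E4 ≃ₗᵢ[ℝ] E4)
    (hP3 : P₀ (EuclideanSpace.single 3 1) = EuclideanSpace.single 3 1) {v : E4} {c : ℝ} (hc : 0 < c)
    (hPv : P₀ v = c • EuclideanSpace.single 2 1) (R : E4 ≃ₗᵢ[ℝ] E4)
    (hR : LinearMap.det (R.toLinearEquiv : E4 →ₗ[ℝ] E4) = 1) (hRv : R v = v)
    (hR3 : R (EuclideanSpace.single 3 1) = EuclideanSpace.single 3 1) :
    ∃ t : ℝ, R = (P₀.trans (planeRot (d := 3) 0 t)).trans P₀.symm := by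
  set C : E4 ≃ₗᵢ[ℝ] E4 := P₀.symm.trans (R.trans P₀) with hC
  have hP2 : P₀.symm (EuclideanSpace.single 2 1) = c⁻¹ • v := by
    apply P₀.injective
    rw [LinearIsometryEquiv.apply_symm_apply, map_smul, hPv, smul_smul, inv_mul_cancel₀ hc.ne', one_smul]
  have hP3' : P₀.symm (EuclideanSpace.single 3 1) = EuclideanSpace.single 3 1 := by
    rw [← hP3, LinearIsometryEquiv.symm_apply_apply, hP3]
  have hC2 : C (EuclideanSpace.single 2 1) = EuclideanSpace.single 2 1 := by
    rw [hC, LinearIsometryEquiv.trans_apply, LinearIsometryEquiv.trans_apply, hP2, map_smul, hRv, map_smul, hPv,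
      smul_smul, inv_mul_cancel₀ hc.ne', one_smul]
  have hC3 : C (EuclideanSpace.single 3 1) = EuclideanSpace.single 3 1 := by
    rw [hC, LinearIsometryEquiv.trans_apply, LinearIsometryEquiv.trans_apply, hP3', hR3, hP3]
  have hCdet : LinearMap.det (C.toLinearEquiv : E4 →ₗ[ℝ] E4) = 1 := by
    have h := det_conj P₀.symm R
    rw [LinearIsometryEquiv.symm_symm] at h
    rw [hC, h, hR]
  obtain ⟨t, ht⟩ := exists_eq_planeRot C hCdet hC2 hC3
  refine ⟨t, ?_⟩
  have h := eq_symm_trans_conj_trans P₀.symm R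
  rw [LinearIsometryEquiv.symm_symm] at h
  rw [h, ← hC, ht]
  ext x : 1
  rfl

section Skew

variable (R₈ Q : E4 ≃ₗᵢ[ℝ] E4)
  (h8 : R₈ (EuclideanSpace.single 0 1) =
      (Real.sqrt 2 / 2) • EuclideanSpace.single 0 1 + (Real.sqrt 2 / 2) • EuclideanSpace.single 1 1 ∧
    R₈ (EuclideanSpace.single 1 1) =
      -((Real.sqrt 2 / 2) • EuclideanSpace.single 0 1) + (Real.sqrt 2 / 2) • EuclideanSpace.single 1 1 ∧
    R₈ (EuclideanSpace.single 2 1) = EuclideanSpace.single 2 1 ∧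
    R₈ (EuclideanSpace.single 3 1) = EuclideanSpace.single 3 1)
  (hQdet : LinearMap.det (Q.toLinearEquiv : E4 →ₗ[ℝ] E4) = 1)
  (hQ : Q (EuclideanSpace.single 0 1) = -EuclideanSpace.single 2 1 ∧
    Q (EuclideanSpace.single 1 1) = EuclideanSpace.single 1 1 ∧
    Q (EuclideanSpace.single 2 1) = EuclideanSpace.single 0 1 ∧
    Q (EuclideanSpace.single 3 1) = EuclideanSpace.single 3 1)
include h8 hQdet hQ

/-- **The skew rotation is an irrational conjugate plane rotation.** With `v = e₀ + (1+√2) e₁ + e₂` there are an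
isometry `P₀` fixing `e₃`, `c > 0` and `φ₀` with `P₀ v = c e₂`, `Q ∘ R₈ = P₀⁻¹ ρ(φ₀) P₀`, `φ₀/2π` irrational, and
every determinant-one isometry fixing `v, e₃` of the form `P₀⁻¹ ρ(t) P₀`. [folklore] -/
theorem skew_conj :
    ∃ (P₀ : E4 ≃ₗᵢ[ℝ] E4) (c φ₀ : ℝ), 0 < c ∧
      P₀ (EuclideanSpace.single 3 1) = EuclideanSpace.single 3 1 ∧
      P₀ (EuclideanSpace.single 0 1 + (1 + Real.sqrt 2) • EuclideanSpace.single 1 1 + EuclideanSpace.single 2 1) =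
        c • EuclideanSpace.single 2 1 ∧
      R₈.trans Q = (P₀.trans (planeRot (d := 3) 0 φ₀)).trans P₀.symm ∧
      Irrational (φ₀ / (2 * Real.pi)) ∧
      ∀ R : E4 ≃ₗᵢ[ℝ] E4, LinearMap.det (R.toLinearEquiv : E4 →ₗ[ℝ] E4) = 1 →
        R (EuclideanSpace.single 0 1 + (1 + Real.sqrt 2) • EuclideanSpace.single 1 1 + EuclideanSpace.single 2 1) =
          EuclideanSpace.single 0 1 + (1 + Real.sqrt 2) • EuclideanSpace.single 1 1 + EuclideanSpace.single 2 1 →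
        R (EuclideanSpace.single 3 1) = EuclideanSpace.single 3 1 →
        ∃ t : ℝ, R = (P₀.trans (planeRot (d := 3) 0 t)).trans P₀.symm := by
  set h : E4 ≃ₗᵢ[ℝ] E4 := R₈.trans Q with hh
  set v : E4 := EuclideanSpace.single 0 1 + (1 + Real.sqrt 2) • EuclideanSpace.single 1 1 +
    EuclideanSpace.single 2 1 with hv
  have hhv : h v = v := skew_apply_axis R₈ Q h8 hQ
  have hh3 : h (EuclideanSpace.single 3 1) = EuclideanSpace.single 3 1 := skew_apply_e3 R₈ Q h8 hQ
  have hhdet : LinearMap.det (h.toLinearEquiv : E4 →ₗ[ℝ] E4) = 1 := by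
    have h01 : ((planeRot (d := 3) 0 (-(Real.pi / 4)) : E4 ≃ₗᵢ[ℝ] E4).toLinearEquiv : E4 →ₗ[ℝ] E4) =
        (R₈.toLinearEquiv : E4 →ₗ[ℝ] E4) := by
      have he : (planeRot (d := 3) 0 (-(Real.pi / 4)) : E4 ≃ₗᵢ[ℝ] E4) = R₈ :=
        (eq_rho_of_apply_single R₈ (-(Real.pi / 4))
          (by rw [h8.1, Real.cos_neg, Real.sin_neg, neg_neg, Real.cos_pi_div_four, Real.sin_pi_div_four])
          (by rw [h8.2.1, Real.cos_neg, Real.sin_neg, Real.cos_pi_div_four, Real.sin_pi_div_four, neg_smul])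
          h8.2.2.1 h8.2.2.2).symm
      rw [he]
    rw [hh, det_trans, ← h01, det_rho, hQdet, one_mul]
  -- an adapted frame
  have hv3 : v 3 = 0 := by simp [hv]
  have hv0 : v ≠ 0 := by
    intro h0
    have h1 : v 0 = 0 := by rw [h0]; rfl
    simp [hv] at h1
  obtain ⟨P₀, -, hP3, c, hc, hPv⟩ := exists_frame v hv3 hv0
  -- `h` is a conjugate plane rotation by an angle `φ₀` with `2 cos φ₀ = √2/2 - 1`
  obtain ⟨φ₀, hφ₀⟩ := exists_eq_conj_rho P₀ hP3 hc hPv h hhdet hhv hh3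
  have hcos : 2 * Real.cos φ₀ = Real.sqrt 2 / 2 - 1 := by
    have h1 : LinearMap.trace ℝ E4 (h.toLinearEquiv : E4 →ₗ[ℝ] E4) = 1 + Real.sqrt 2 / 2 :=
      trace_skew R₈ Q h8 hQ
    have h2 : LinearMap.trace ℝ E4 (h.toLinearEquiv : E4 →ₗ[ℝ] E4) = 2 * Real.cos φ₀ + 2 := by
      have h3 : h = P₀.trans ((planeRot (d := 3) 0 φ₀).trans P₀.symm) := by
        rw [hφ₀]
        ext x : 1
        rfl
      rw [h3, trace_conj, trace_rho]
    linarith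
  exact ⟨P₀, c, φ₀, hc, hP3, hPv, hφ₀, irrational_of_two_mul_cos_eq hcos,
    fun R hR hRv hR3 => exists_eq_conj_rho P₀ hP3 hc hPv R hR hRv hR3⟩

end Skew

end OneAngle

/-- **Registered sub-goal `oneAngleSkew` of stub `stub_oneAngleAmplification`** (= `OneAngle.skew_conj` over
Mathlib/tree vocabulary): the skew rotation `Q ∘ R₈` (`R₈` the eighth-turn of the `(x₀,x₁)`-plane, `Q` the
quarter-turn `e₀ ↦ -e₂, e₂ ↦ e₀`) is, in a frame `P₀` adapted to its axis `v = e₀ + (1+√2) e₁ + e₂`, a plane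
rotation by an angle `φ₀` with `φ₀/2π` IRRATIONAL, and the determinant-one isometries fixing `v, e₃` are exactly
such conjugates. [folklore] -/
theorem oneAngleSkew :
    ∀ R₈ Q : EuclideanSpace ℝ (Fin 4) ≃ₗᵢ[ℝ] EuclideanSpace ℝ (Fin 4),
      (R₈ (EuclideanSpace.single 0 1) =
          (Real.sqrt 2 / 2) • EuclideanSpace.single 0 1 + (Real.sqrt 2 / 2) • EuclideanSpace.single 1 1 ∧
        R₈ (EuclideanSpace.single 1 1) =
          -((Real.sqrt 2 / 2) • EuclideanSpace.single 0 1) + (Real.sqrt 2 / 2) • EuclideanSpace.single 1 1 ∧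
        R₈ (EuclideanSpace.single 2 1) = EuclideanSpace.single 2 1 ∧
        R₈ (EuclideanSpace.single 3 1) = EuclideanSpace.single 3 1) →
      LinearMap.det (Q.toLinearEquiv : EuclideanSpace ℝ (Fin 4) →ₗ[ℝ] EuclideanSpace ℝ (Fin 4)) = 1 →
      (Q (EuclideanSpace.single 0 1) = -EuclideanSpace.single 2 1 ∧
        Q (EuclideanSpace.single 1 1) = EuclideanSpace.single 1 1 ∧
        Q (EuclideanSpace.single 2 1) = EuclideanSpace.single 0 1 ∧
        Q (EuclideanSpace.single 3 1) = EuclideanSpace.single 3 1) →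
      ∃ (P₀ : EuclideanSpace ℝ (Fin 4) ≃ₗᵢ[ℝ] EuclideanSpace ℝ (Fin 4)) (c φ₀ : ℝ), 0 < c ∧
        P₀ (EuclideanSpace.single 3 1) = EuclideanSpace.single 3 1 ∧
        P₀ (EuclideanSpace.single 0 1 + (1 + Real.sqrt 2) • EuclideanSpace.single 1 1 + EuclideanSpace.single 2 1) =
          c • EuclideanSpace.single 2 1 ∧
        R₈.trans Q = (P₀.trans (Literature.MathematicalPhysics.QuantumFieldTheory.planeRot (d := 3) 0 φ₀)).trans
          P₀.symm ∧
        Irrational (φ₀ / (2 * Real.pi)) ∧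
        ∀ R : EuclideanSpace ℝ (Fin 4) ≃ₗᵢ[ℝ] EuclideanSpace ℝ (Fin 4),
          LinearMap.det (R.toLinearEquiv : EuclideanSpace ℝ (Fin 4) →ₗ[ℝ] EuclideanSpace ℝ (Fin 4)) = 1 →
          R (EuclideanSpace.single 0 1 + (1 + Real.sqrt 2) • EuclideanSpace.single 1 1 + EuclideanSpace.single 2 1) =
            EuclideanSpace.single 0 1 + (1 + Real.sqrt 2) • EuclideanSpace.single 1 1 + EuclideanSpace.single 2 1 →
          R (EuclideanSpace.single 3 1) = EuclideanSpace.single 3 1 →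
          ∃ t : ℝ, R = (P₀.trans (Literature.MathematicalPhysics.QuantumFieldTheory.planeRot (d := 3) 0 t)).trans
            P₀.symm :=
  fun R₈ Q h8 hQdet hQ => OneAngle.skew_conj R₈ Q h8 hQdet hQ

end Summit.QuantumFields.YangMills.Theorems.NPointIsotropy.QuarterTurnCornerOperator

end
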